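import Summits.HubbardSuperconductivity.HubbardSuperconductivity.Theses.TwistGap
import Summits.HubbardSuperconductivity.HubbardSuperconductivity.Theorems.DeformationLadderLowEnergyRigidityOrderCeiling
import Summits.HubbardSuperconductivity.HubbardSuperconductivity.Theorems.DeformationLadderLadderThesisRigidityReduction
import HarnessLib

/-!
# `LowEnergyRigidity` (stmt-HubbardSuperconductivity-1892) — the weak-coupling order ceiling, BY NAME

Corollaries of `OrderCeiling.order_le_sqrt_coupling` (`…OrderCeiling.lean`) in the exact matrices of
the three members of the corner class and in the summit's ground-state form:
* `lowEnergyRigidity_witness_order_le` — witnesses `(U, δ, κ, a, L₀)` of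
  `DeformationLadder.LowEnergyRigidity` have `a ≤ 64√2·√U` (test state: a sector ground state);
* `groundState_order_le` — the same for sequences of sector GROUND STATES with LRO `≥ a` (summit form);
* `ladderThesis_witness_order_le` — witnesses `(U, δ, s, a, L₀)` of `DeformationLadder.LadderThesis`
  (the penalised ground state lies within `32 s` of the pure sector energy, `minEnergyOn_penalised_le`);
* `tgThesis_witness_order_le` — witnesses `(U, δ, λ, c, L₀)` of `TwistGap.TgThesis` have `c ≤ 64√2·√U`;
* `not_uniform_order_floor` — REFUTED STRENGTHENING: no floor `a > 0` serves `LowEnergyRigidity` for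
  all `U` in an interval `(0, U₁)` (at `U = min(U₁/2, a²/16384)` the ceiling reads `a ≤ a/√2`).
Each item fixes one `U > 0`, so nothing here refutes an item; the ceiling quantifies
`Literature.Barriers.HubbardSuperconductivity.WeakCouplingCeiling` on these decls.
Kaplan–Horsch–von der Linden (1989); Bru–de Siqueira Pedra (2013) Thm 107.
-/

noncomputable section

set_option linter.dupNamespace false

namespace Summit.HubbardSuperconductivity.HubbardSuperconductivity.Theorems.LowEnergyRigidity.OrderCeiling

open Matrix
open Literature.MathematicalPhysics.QuantumLattice Literature.Probability.LatticeModels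
open scoped ComplexOrder

/-! ### Corollaries by name: `LowEnergyRigidity`, `LadderThesis`, `TgThesis`, the summit form -/

/-- **Ceiling for `LowEnergyRigidity` witnesses** (stmt-HubbardSuperconductivity-1892). If
`(U, δ, κ, a, L₀)` satisfies the matrix of `DeformationLadder.LowEnergyRigidity` (with `U ≥ 0`,
`κ ≥ 0`), then `a ≤ 64√2·√U`: the rigid order of the corner is `O(√U)` at weak coupling.
[cite: BruPedra2013, Thm 107] -/
theorem lowEnergyRigidity_witness_order_le {U δ κ a : ℝ} {L₀ : ℕ} (hU : 0 ≤ U)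
    (hδ : δ ∈ Set.Ioo (0 : ℝ) (1 / 2)) (hκ : 0 ≤ κ)
    (h : ∀ (L : ℕ) [NeZero L], L₀ ≤ L → Even L → ∀ φ : Fock (Orb (FermionTorus 2 L)),
      φ ∈ szSector (2 * ⌊(1 - δ) * (L : ℝ) ^ 2 / 2⌋₊) 0 → star φ ⬝ᵥ φ = 1 →
      (star φ ⬝ᵥ Matrix.mulVec (hubbardTorus 2 L 1 U) φ).re ≤
        (hubbardTorus 2 L 1 U).minEnergyOn (szSector (2 * ⌊(1 - δ) * (L : ℝ) ^ 2 / 2⌋₊) 0) + κ →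
      a ≤ (expect ((pairField dWaveFormFactor L)ᴴ * pairField dWaveFormFactor L) φ).re /
        (L : ℝ) ^ 4) :
    a ≤ 64 * Real.sqrt 2 * Real.sqrt U := by
  refine order_le_sqrt_coupling (δ := δ) (κ := κ) hU (by linarith [hδ.2]) (by linarith [hδ.1])
    ⟨L₀, fun L _ hL hev => ?_⟩
  have hn : ⌊(1 - δ) * (L : ℝ) ^ 2 / 2⌋₊ ≤ L ^ 2 := NoGo.floor_pairNumber_le δ (by linarith [hδ.1]) L
  obtain ⟨ψ, hψ1, hψK, -, hψeig⟩ := NoGo.exists_unit_groundStateInSector_hubbardTorus L 1 U hn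
  have hE : (star ψ ⬝ᵥ (hubbardTorus 2 L 1 U *ᵥ ψ)).re =
      (hubbardTorus 2 L 1 U).minEnergyOn (szSector (2 * ⌊(1 - δ) * (L : ℝ) ^ 2 / 2⌋₊) 0) := by
    rw [hψeig, dotProduct_smul, hψ1, smul_eq_mul, mul_one, Complex.ofReal_re]
  exact ⟨ψ, hψK, hψ1, by rw [hE]; linarith, h L hL hev ψ hψK hψ1 (by rw [hE]; linarith)⟩

/-- **Ceiling in the summit's form** (every / some sequence of sector GROUND STATES with LRO
density `≥ a` at `(U, δ)`): `a ≤ 64√2·√U`. [cite: BruPedra2013, Thm 107] -/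
theorem groundState_order_le {U δ a : ℝ} (hU : 0 ≤ U) (hδ : δ ∈ Set.Ioo (0 : ℝ) (1 / 2))
    (h : ∃ L₀ : ℕ, ∀ (L : ℕ) [NeZero L], L₀ ≤ L → Even L → ∃ ψ : Fock (Orb (FermionTorus 2 L)),
      star ψ ⬝ᵥ ψ = 1 ∧
      IsGroundStateInSector (hubbardTorus 2 L 1 U) (2 * ⌊(1 - δ) * (L : ℝ) ^ 2 / 2⌋₊) 0 ψ ∧
      a ≤ (expect ((pairField dWaveFormFactor L)ᴴ * pairField dWaveFormFactor L) ψ).re /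
        (L : ℝ) ^ 4) :
    a ≤ 64 * Real.sqrt 2 * Real.sqrt U := by
  obtain ⟨L₀, hL₀⟩ := h
  refine order_le_sqrt_coupling (δ := δ) (κ := 0) hU (by linarith [hδ.2]) (by linarith [hδ.1])
    ⟨L₀, fun L _ hL hev => ?_⟩
  obtain ⟨ψ, hψ1, ⟨hψK, -, hψeig⟩, hψa⟩ := hL₀ L hL hev
  have hE : (star ψ ⬝ᵥ (hubbardTorus 2 L 1 U *ᵥ ψ)).re =
      (hubbardTorus 2 L 1 U).minEnergyOn (szSector (2 * ⌊(1 - δ) * (L : ℝ) ^ 2 / 2⌋₊) 0) := by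
    rw [hψeig, dotProduct_smul, hψ1, smul_eq_mul, mul_one, Complex.ofReal_re]
  exact ⟨ψ, hψK, hψ1, by rw [hE]; linarith, hψa⟩

/-- **Ceiling for `LadderThesis` witnesses** (stmt-HubbardSuperconductivity-1890). If
`(U, δ, s, a, L₀)` satisfies the matrix of `DeformationLadder.LadderThesis` (some normalised
sector ground state of the penalised model `H_L(U) + (s/L⁴)Δ_dᴴΔ_d` has LRO density `≥ a` at every
large even `L`; `U, s ≥ 0`), then `a ≤ 64√2·√U`: the penalised ground state lies within `32 s` of
the pure sector energy (`minEnergyOn_penalised_le`). [cite: KaplanHorschVonDerLinden1989] -/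
theorem ladderThesis_witness_order_le {U δ s a : ℝ} {L₀ : ℕ} (hU : 0 ≤ U)
    (hδ : δ ∈ Set.Ioo (0 : ℝ) (1 / 2)) (hs : 0 ≤ s)
    (h : ∀ (L : ℕ) [NeZero L], L₀ ≤ L → Even L → ∃ φ : Fock (Orb (FermionTorus 2 L)),
      star φ ⬝ᵥ φ = 1 ∧
      IsGroundStateInSector (hubbardTorus 2 L 1 U + ((s / (L : ℝ) ^ 4 : ℝ) : ℂ) •
        ((pairField dWaveFormFactor L)ᴴ * pairField dWaveFormFactor L))
        (2 * ⌊(1 - δ) * (L : ℝ) ^ 2 / 2⌋₊) 0 φ ∧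
      a ≤ (expect ((pairField dWaveFormFactor L)ᴴ * pairField dWaveFormFactor L) φ).re /
        (L : ℝ) ^ 4) :
    a ≤ 64 * Real.sqrt 2 * Real.sqrt U := by
  refine order_le_sqrt_coupling (δ := δ) (κ := 32 * s) hU (by linarith [hδ.2]) (by linarith [hδ.1])
    ⟨L₀, fun L _ hL hev => ?_⟩
  obtain ⟨φ, hφ1, ⟨hφK, -, hφeig⟩, hφa⟩ := h L hL hev
  refine ⟨φ, hφK, hφ1, ?_, hφa⟩
  have hL0 : (0 : ℝ) < L := by exact_mod_cast Nat.pos_of_ne_zero (NeZero.ne L)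
  have hL4 : (0 : ℝ) < (L : ℝ) ^ 4 := by positivity
  have hEs : (star φ ⬝ᵥ ((hubbardTorus 2 L 1 U + ((s / (L : ℝ) ^ 4 : ℝ) : ℂ) •
      ((pairField dWaveFormFactor L)ᴴ * pairField dWaveFormFactor L)) *ᵥ φ)).re =
      (hubbardTorus 2 L 1 U + ((s / (L : ℝ) ^ 4 : ℝ) : ℂ) •
        ((pairField dWaveFormFactor L)ᴴ * pairField dWaveFormFactor L)).minEnergyOn
        (szSector (2 * ⌊(1 - δ) * (L : ℝ) ^ 2 / 2⌋₊) 0) := by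
    rw [hφeig, dotProduct_smul, hφ1, smul_eq_mul, mul_one, Complex.ofReal_re]
  have hsplit : (star φ ⬝ᵥ ((hubbardTorus 2 L 1 U + ((s / (L : ℝ) ^ 4 : ℝ) : ℂ) •
      ((pairField dWaveFormFactor L)ᴴ * pairField dWaveFormFactor L)) *ᵥ φ)).re =
      (star φ ⬝ᵥ (hubbardTorus 2 L 1 U *ᵥ φ)).re + s / (L : ℝ) ^ 4 *
        (star φ ⬝ᵥ (((pairField dWaveFormFactor L)ᴴ * pairField dWaveFormFactor L) *ᵥ φ)).re := by
    rw [add_mulVec, smul_mulVec, dotProduct_add, dotProduct_smul, smul_eq_mul, Complex.add_re,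
      Complex.re_ofReal_mul]
  have hpen := Summit.HubbardSuperconductivity.HubbardSuperconductivity.Theorems.DeformationLadder.minEnergyOn_penalised_le
    L U hs (szSector (2 * ⌊(1 - δ) * (L : ℝ) ^ 2 / 2⌋₊) 0) ⟨φ, hφK, hφ1⟩
  have hPnn := Summit.HubbardSuperconductivity.HubbardSuperconductivity.Theorems.DeformationLadder.re_expect_pairPenalty_nonneg
    L φ
  rw [Literature.MathematicalPhysics.QuantumLattice.expect] at hPnn
  have hnn : 0 ≤ s / (L : ℝ) ^ 4 *
      (star φ ⬝ᵥ (((pairField dWaveFormFactor L)ᴴ * pairField dWaveFormFactor L) *ᵥ φ)).re :=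
    mul_nonneg (div_nonneg hs hL4.le) hPnn
  linarith [hEs, hsplit, hpen]

/-- **Ceiling for `TwistGap.TgThesis` witnesses** (stmt-HubbardSuperconductivity-1508, the
penalty-gap member of the class). If `(U, δ, λ, c, L₀)` satisfies the matrix of `TwistGap.TgThesis`
(`c ≤ LRO(φ) + λ·(excess energy of φ)` for every unit sector `φ`; `U ≥ 0`), then `c ≤ 64√2·√U`
(test it on a sector ground state). [cite: BruPedra2013, Thm 107] -/
theorem tgThesis_witness_order_le {U δ lam c : ℝ} {L₀ : ℕ} (hU : 0 ≤ U)
    (hδ : δ ∈ Set.Ioo (0 : ℝ) (1 / 2))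
    (h : ∀ (L : ℕ) [NeZero L], L₀ ≤ L → Even L → ∀ φ : Fock (Orb (FermionTorus 2 L)),
      φ ∈ szSector (2 * ⌊(1 - δ) * (L : ℝ) ^ 2 / 2⌋₊) 0 → star φ ⬝ᵥ φ = 1 →
      c ≤ (expect ((pairField dWaveFormFactor L)ᴴ * pairField dWaveFormFactor L) φ).re /
        (L : ℝ) ^ 4 + lam * ((expect (hubbardTorus 2 L 1 U) φ).re -
          (hubbardTorus 2 L 1 U).minEnergyOn (szSector (2 * ⌊(1 - δ) * (L : ℝ) ^ 2 / 2⌋₊) 0))) :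
    c ≤ 64 * Real.sqrt 2 * Real.sqrt U := by
  refine order_le_sqrt_coupling (δ := δ) (κ := 0) hU (by linarith [hδ.2]) (by linarith [hδ.1])
    ⟨L₀, fun L _ hL hev => ?_⟩
  have hn : ⌊(1 - δ) * (L : ℝ) ^ 2 / 2⌋₊ ≤ L ^ 2 := NoGo.floor_pairNumber_le δ (by linarith [hδ.1]) L
  obtain ⟨ψ, hψ1, hψK, -, hψeig⟩ := NoGo.exists_unit_groundStateInSector_hubbardTorus L 1 U hn
  have hE : (star ψ ⬝ᵥ (hubbardTorus 2 L 1 U *ᵥ ψ)).re =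
      (hubbardTorus 2 L 1 U).minEnergyOn (szSector (2 * ⌊(1 - δ) * (L : ℝ) ^ 2 / 2⌋₊) 0) := by
    rw [hψeig, dotProduct_smul, hψ1, smul_eq_mul, mul_one, Complex.ofReal_re]
  have hc := h L hL hev ψ hψK hψ1
  simp only [Literature.MathematicalPhysics.QuantumLattice.expect] at hc
  rw [hE, sub_self, mul_zero, add_zero] at hc
  exact ⟨ψ, hψK, hψ1, by rw [hE]; linarith, hc⟩

/-- **REFUTED STRENGTHENING: no `U`-uniform order floor.** There is no floor `a > 0`, doping
`δ ∈ (0, 1/2)`, window `κ ≥ 0` and `U₁ > 0` such that the matrix of `LowEnergyRigidity` holds at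
`(U, δ, κ, a)` for EVERY `U ∈ (0, U₁)`: at `U = min(U₁/2, a²/16384)` the ceiling gives
`a ≤ 64√2·√U ≤ a/√2 < a`. (The item itself fixes one `U`, so this refutes only the uniform
variant.) [cite: BruPedra2013, Thm 107] -/
theorem not_uniform_order_floor :
    ¬ ∃ a : ℝ, 0 < a ∧ ∃ δ ∈ Set.Ioo (0 : ℝ) (1 / 2), ∃ κ : ℝ, 0 ≤ κ ∧ ∃ U₁ : ℝ, 0 < U₁ ∧
      ∀ U ∈ Set.Ioo (0 : ℝ) U₁, ∃ L₀ : ℕ, ∀ (L : ℕ) [NeZero L], L₀ ≤ L → Even L →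
        ∀ φ : Fock (Orb (FermionTorus 2 L)),
          φ ∈ szSector (2 * ⌊(1 - δ) * (L : ℝ) ^ 2 / 2⌋₊) 0 → star φ ⬝ᵥ φ = 1 →
          (star φ ⬝ᵥ Matrix.mulVec (hubbardTorus 2 L 1 U) φ).re ≤
            (hubbardTorus 2 L 1 U).minEnergyOn (szSector (2 * ⌊(1 - δ) * (L : ℝ) ^ 2 / 2⌋₊) 0) + κ →
          a ≤ (expect ((pairField dWaveFormFactor L)ᴴ * pairField dWaveFormFactor L) φ).re /
            (L : ℝ) ^ 4 := by
  rintro ⟨a, ha, δ, hδ, κ, hκ, U₁, hU₁, h⟩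
  set U : ℝ := min (U₁ / 2) (a ^ 2 / 16384) with hUdef
  have hUpos : 0 < U := lt_min (by linarith) (by positivity)
  have hUlt : U < U₁ := (min_le_left _ _).trans_lt (by linarith)
  obtain ⟨L₀, hL₀⟩ := h U ⟨hUpos, hUlt⟩
  have hle := lowEnergyRigidity_witness_order_le hUpos.le hδ hκ hL₀
  have hsU : Real.sqrt U ≤ a / 128 :=
    Real.sqrt_le_iff.2 ⟨by positivity, (min_le_right _ _).trans (le_of_eq (by ring))⟩
  have hr : Real.sqrt 2 < 2 := (Real.sqrt_lt' two_pos).2 (by norm_num)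
  nlinarith [Real.sqrt_nonneg 2, Real.sqrt_nonneg U, hle, hsU, hr,
    mul_le_mul_of_nonneg_left hsU (Real.sqrt_nonneg 2)]

end Summit.HubbardSuperconductivity.HubbardSuperconductivity.Theorems.LowEnergyRigidity.OrderCeiling
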